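import Literature.Probability.Percolation.SlabRSWGluingCrossRoute
import Literature.Probability.Percolation.SlabRSWGluingRoute
import HarnessLib

/-!
# Newman–Tassion–Wu 2017, §3.2 (Remark 2) — the plain surgery when the minimal-path domain is
# locally a cross (e.g. `L`-shaped)

Topic: `Literature/Probability/Percolation`. Companion of `GlueData.exists_surgery_rectBelow` (locally
rectangular domains) for the remaining local geometries of NTW's rectilinear domains: near an inner
corner of `S` the cleared box `D` meets `S` in an `L`, more generally in a cross `Λ = A ∪ B` of two
bars with a common block of at least `3 × 4` cells. If the vertices of `Γ = Γ_min^S(A,B)` over `D` lie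
over `Λ ⊆ S ∩ D`, two of them are distinct, and the port's neighbour `w'` lies over `Λ` on no cell of
`Γ` (generic position: the far path stays at distance `> ρ ≥ 0` from `Γ̄`), then the route of
`exists_route_cross` and the tree's `exists_surgery_of_route` give a surgery with cleared set `D`
(`GlueData.exists_surgery_cross`).

## Sources

* C. M. Newman, V. Tassion, W. Wu, *Critical percolation and the minimal spanning tree in slabs*,
  Comm. Pure Appl. Math. 70 (2017), arXiv:1512.09107: §3.2, proof of Theorem 3.7, steps (1)–(3),
  Remark 2 ("the proof also applies if the sets R and S are … rectilinear domains")
  [NewmanTassionWu2017].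
-/

noncomputable section

namespace Literature.Probability.Percolation

open LatticeModels SimpleGraph

namespace NTW17

namespace GlueData

variable {k : ℕ} {Q : GlueData} {ω : BondConfig (slab 3 k)}

/-- **The plain surgery, locally cross-shaped form.** Let `Q` be any gluing datum, `ω ∈ 𝒳` a lattice
configuration, `D ⊆ R` a cleared set off `A` and `B`, and `Λ = A' ∪ B'` a cross of two bars
(`A' = [xL,xR] × [r₁,r₂]`, `B' = [c₁,c₂] × [rB,rT]`, meeting in a block of at least `3 × 4` cells) with
`Λ ⊆ S` and `Λ ⊆ D`, such that every vertex of `Γ` over `D` lies over `Λ` and two of them are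
distinct. Given port data — a lattice neighbour `q₁ ∉ D̄` of a vertex `w'` over `Λ` lying on no cell of
`Γ`, joined to `C̄` inside `(R ∖ D)‾` — there is a surgery with cleared set `D`.
[cite: NewmanTassionWu2017, §3.2 (proof of Theorem 3.7, steps (1)–(3); Remark 2)] -/
theorem exists_surgery_cross (hk : 1 ≤ k) (hX : ω ∈ Q.evX k) {D : Set (ℤ × ℤ)} (hDR : D ⊆ Q.R)
    (hDA : ∀ z ∈ D, z ∉ Q.A) (hDB : ∀ z ∈ D, z ∉ Q.B)
    {xL xR rB rT r₁ r₂ c₁ c₂ : ℤ} (hcols : xL + 2 ≤ xR) (hrows : rB + 3 ≤ rT)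
    (hr₁ : r₁ ≤ rB) (hr₂ : rT ≤ r₂) (hc₁ : c₁ ≤ xL) (hc₂ : xR ≤ c₂)
    (hΛS : boxR xL xR r₁ r₂ ∪ boxR c₁ c₂ rB rT ⊆ Q.S) (hΛD : boxR xL xR r₁ r₂ ∪ boxR c₁ c₂ rB rT ⊆ D)
    (hγΛ : ∀ v ∈ Q.γ k ω, planar k v ∈ D → planar k v ∈ boxR xL xR r₁ r₂ ∪ boxR c₁ c₂ rB rT)
    (htwo : ∃ x ∈ Q.γ k ω, ∃ y ∈ Q.γ k ω, x ≠ y ∧ planar k x ∈ D ∧ planar k y ∈ D)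
    {w' q₁ cC : slab 3 k} (hadj : (slabGraph 3 k).Adj w' q₁) (hq₁D : planar k q₁ ∉ D)
    (hcC : cC ∈ slabLift k Q.C) (hσ : ω ∈ openConnIn (slabLift k (Q.R \ D)) q₁ cC)
    (hw'Λ : planar k w' ∈ boxR xL xR r₁ r₂ ∪ boxR c₁ c₂ rB rT)
    (hw'γ : ∀ v ∈ Q.γ k ω, planar k v ≠ planar k w') :
    ∃ sx : Q.Surgery k ω, sx.D = D :=
  exists_surgery_of_route hX hDR hDA hDB hΛD hΛS htwo hadj hq₁D hcC hσ
    fun E₁ E₂ hE₁ hE₂ hne hE₁D hE₂D => by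
      obtain ⟨L, Br, c, spec⟩ := exists_route_cross hk hcols hrows hr₁ hr₂ hc₁ hc₂ (hγΛ E₁ hE₁ hE₁D)
        (hγΛ E₂ hE₂ hE₂D) hw'Λ hne (hw'γ E₁ hE₁) (hw'γ E₂ hE₂)
      exact ⟨L, Br, c, RouteSpec.mono spec subset_rfl hΛD⟩

end GlueData

end NTW17

end Literature.Probability.Percolation

end
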